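import Literature.NumberTheory.EllipticCurves.IsogenyModularEquation
import Literature.NumberTheory.EllipticCurves.ModularPolynomialDegY
import Mathlib.NumberTheory.Padics.PadicNorm
import HarnessLib

/-!
# Card `optimal-pivot-spine`, transport (T_val): the ultrametric root bound for `Φ_ℓ`

If `Φ_ℓ(x, y) = 0` (the integer modular equation of the tree, `intModularPolynomial ℓ ∈ ℤ[Y][X]`,
monic of degree `ℓ + 1` in `X`, of degree `≤ ℓ + 1` in `Y`) and `|x|_q > 1`, then
`|x|_q ≤ max(1, |y|_q)^(ℓ+1)`; hence `|y|_q > 1` too and `|x|_q ≤ |y|_q^(ℓ+1)`, i.e.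
`|v_q(x)| ≤ (ℓ + 1) |v_q(y)|` for the (negative) valuations. Applied to `x = j(W')`, `y = j(W)`
along a prime-degree `ℚ`-isogeny (`evalXY_intModularPolynomial_j_of_degree_eq_prime`) at a
multiplicative prime (`v_q(j) = -ord_q Δ_min < 0`) this is the local half of Pasten's Lemma 6.8
with constant `ℓ + 1` in place of `ℓ`, WITHOUT Néron models or the Tate curve. Sorry-free.
-/

set_option linter.dupNamespace false

noncomputable section

open scoped BigOperators

namespace Summit.ABC.ABC.Cruxes.DefiniteRTControlPrime.Sketch

open Literature.NumberTheory.EllipticCurves Polynomial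

/-- **Ultrametric root bound for the modular equation.** If `Φ_ℓ(x, y) = 0` over `ℚ` and
`|x|_q > 1` for a prime `q`, then `|x|_q ≤ max(1, |y|_q) ^ (ℓ + 1)`: in `x^{ℓ+1} = -Σ_{m ≤ ℓ} c_m(y) x^m`
(monicity in `X`) every term on the right has `q`-adic norm `≤ max(1,|y|)^{ℓ+1} |x|^ℓ` because the
`c_m ∈ ℤ[Y]` have degree `≤ ℓ + 1`. -/
theorem padicNorm_le_of_evalXY_intModularPolynomial_eq_zero (ℓ : ℕ) [Fact ℓ.Prime] (q : ℕ)
    [Fact q.Prime] {x y : ℚ} (h : evalXY (intModularPolynomial ℓ) x y = 0)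
    (hx : 1 < padicNorm q x) :
    padicNorm q x ≤ (max 1 (padicNorm q y)) ^ (ℓ + 1) := by
  set Φ := intModularPolynomial ℓ with hΦ
  have hsum := evalXY_eq_sum Φ x y (RX := ℓ + 2) (RY := ℓ + 2)
    (by rw [hΦ, natDegree_intModularPolynomial]; omega)
    (fun m => lt_of_le_of_lt (natDegree_coeff_intModularPolynomial_le ℓ m) (by omega))
  rw [h, Finset.sum_range_succ] at hsum
  -- the top term is `x ^ (ℓ + 1)`
  have hc : Φ.coeff (ℓ + 1) = 1 := by
    have hm := monic_intModularPolynomial ℓ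
    rw [Polynomial.Monic, Polynomial.leadingCoeff, natDegree_intModularPolynomial] at hm
    exact hm
  have htop : ∑ i ∈ Finset.range (ℓ + 2), (((Φ.coeff (ℓ + 1)).coeff i : ℤ) : ℚ) * y ^ i * x ^ (ℓ + 1)
      = x ^ (ℓ + 1) := by
    rw [hc, Finset.sum_eq_single 0]
    · simp
    · intro i _ hi
      rw [Polynomial.coeff_one, if_neg hi]
      simp
    · intro h0
      exact absurd (Finset.mem_range.mpr (by omega)) h0
  rw [htop] at hsum
  -- so `x^(ℓ+1) = - S`
  set S := ∑ m ∈ Finset.range (ℓ + 1), ∑ i ∈ Finset.range (ℓ + 2),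
      (((Φ.coeff m).coeff i : ℤ) : ℚ) * y ^ i * x ^ m with hS
  have hxS : x ^ (ℓ + 1) = -S := by linear_combination hsum.symm
  -- bound `|S|`
  set B := max 1 (padicNorm q y) with hB
  have hB1 : 1 ≤ B := le_max_left _ _
  have hx1 : 1 ≤ padicNorm q x := hx.le
  have hbound : padicNorm q S ≤ B ^ (ℓ + 1) * padicNorm q x ^ ℓ := by
    have ht : 0 ≤ B ^ (ℓ + 1) * padicNorm q x ^ ℓ := by positivity
    refine padicNorm.sum_le' (fun m hm => ?_) ht
    refine padicNorm.sum_le' (fun i hi => ?_) ht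
    rw [Finset.mem_range] at hm hi
    rw [padicNorm.mul, padicNorm.mul, IsAbsoluteValue.abv_pow (padicNorm q),
      IsAbsoluteValue.abv_pow (padicNorm q)]
    have h1 : padicNorm q (((Φ.coeff m).coeff i : ℤ) : ℚ) ≤ 1 := padicNorm.of_int _
    have h2 : padicNorm q y ^ i ≤ B ^ (ℓ + 1) :=
      calc padicNorm q y ^ i ≤ B ^ i := pow_le_pow_left₀ (padicNorm.nonneg _) (le_max_right _ _) i
        _ ≤ B ^ (ℓ + 1) := pow_le_pow_right₀ hB1 (by omega)
    have h3 : padicNorm q x ^ m ≤ padicNorm q x ^ ℓ := pow_le_pow_right₀ hx1 (by omega)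
    calc padicNorm q (((Φ.coeff m).coeff i : ℤ) : ℚ) * padicNorm q y ^ i * padicNorm q x ^ m
        ≤ 1 * B ^ (ℓ + 1) * padicNorm q x ^ ℓ :=
          mul_le_mul (mul_le_mul h1 h2 (pow_nonneg (padicNorm.nonneg _) _) zero_le_one) h3
            (pow_nonneg (padicNorm.nonneg _) _) (by positivity)
      _ = B ^ (ℓ + 1) * padicNorm q x ^ ℓ := by ring
  -- conclude
  have hkey : padicNorm q x ^ ℓ * padicNorm q x ≤ padicNorm q x ^ ℓ * B ^ (ℓ + 1) := by
    calc padicNorm q x ^ ℓ * padicNorm q x = padicNorm q (x ^ (ℓ + 1)) := by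
          rw [IsAbsoluteValue.abv_pow (padicNorm q), pow_succ]
      _ = padicNorm q S := by rw [hxS, padicNorm.neg]
      _ ≤ B ^ (ℓ + 1) * padicNorm q x ^ ℓ := hbound
      _ = padicNorm q x ^ ℓ * B ^ (ℓ + 1) := by ring
  have hpos : 0 < padicNorm q x ^ ℓ := by positivity
  exact le_of_mul_le_mul_left hkey hpos

/-- **Corollary (both norms exceed `1`, and the exponent bound).** Under the same hypotheses
`|y|_q > 1` and `|x|_q ≤ |y|_q ^ (ℓ + 1)`. -/
theorem padicNorm_le_pow_of_evalXY_intModularPolynomial_eq_zero (ℓ : ℕ) [Fact ℓ.Prime] (q : ℕ)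
    [Fact q.Prime] {x y : ℚ} (h : evalXY (intModularPolynomial ℓ) x y = 0)
    (hx : 1 < padicNorm q x) :
    1 < padicNorm q y ∧ padicNorm q x ≤ padicNorm q y ^ (ℓ + 1) := by
  have key := padicNorm_le_of_evalXY_intModularPolynomial_eq_zero ℓ q h hx
  by_cases hy : padicNorm q y ≤ 1
  · rw [max_eq_left hy, one_pow] at key
    exact absurd (lt_of_lt_of_le hx key) (lt_irrefl _)
  · rw [not_le] at hy
    rw [max_eq_right hy.le] at key
    exact ⟨hy, key⟩

/-- **Valuation form.** If `Φ_ℓ(x, y) = 0`, `x ≠ 0`, `y ≠ 0` and `v_q(x) < 0`, then `v_q(y) < 0` and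
`(ℓ + 1) · v_q(y) ≤ v_q(x)`, i.e. `|v_q(x)| ≤ (ℓ + 1) |v_q(y)|`. -/
theorem padicValRat_bound_of_evalXY_intModularPolynomial_eq_zero (ℓ : ℕ) [Fact ℓ.Prime] (q : ℕ)
    [Fact q.Prime] {x y : ℚ} (hx0 : x ≠ 0) (hy0 : y ≠ 0)
    (h : evalXY (intModularPolynomial ℓ) x y = 0) (hvx : padicValRat q x < 0) :
    padicValRat q y < 0 ∧ ((ℓ + 1 : ℕ) : ℤ) * padicValRat q y ≤ padicValRat q x := by
  have hq1 : (1 : ℚ) < q := by exact_mod_cast (Fact.out : q.Prime).one_lt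
  have hnx : padicNorm q x = (q : ℚ) ^ (-padicValRat q x) := padicNorm.eq_zpow_of_nonzero hx0
  have hny : padicNorm q y = (q : ℚ) ^ (-padicValRat q y) := padicNorm.eq_zpow_of_nonzero hy0
  have hx : 1 < padicNorm q x := by
    rw [hnx]
    exact one_lt_zpow₀ hq1 (by omega)
  obtain ⟨hy, hle⟩ := padicNorm_le_pow_of_evalXY_intModularPolynomial_eq_zero ℓ q h hx
  rw [hny] at hy
  have hvy : padicValRat q y < 0 := by
    by_contra hcon
    rw [not_lt] at hcon
    have : (q : ℚ) ^ (-padicValRat q y) ≤ 1 := zpow_le_one_of_nonpos₀ hq1.le (by omega)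
    exact absurd (lt_of_lt_of_le hy this) (lt_irrefl _)
  refine ⟨hvy, ?_⟩
  rw [hnx, hny, ← zpow_natCast, ← zpow_mul] at hle
  have hle' := (zpow_le_zpow_iff_right₀ hq1).mp hle
  linarith

end Summit.ABC.ABC.Cruxes.DefiniteRTControlPrime.Sketch

end
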